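import Summits.Ventures.PercRepro.Night2LocalTwoTwoX

/-!
# PercRepro — counting lemmas for simple planes (night-2, gen 9)

The counting lemmas of the scheme S6 for the type `(2, 1)` (NIGHT-2-local.md §19 ADDENDUM 8): (i) in a set `U` of
rank `3` with at least `4` elements, pairwise of rank `2` (no parallel pairs), at most one element `e` has
`U ∖ {e}` of rank `2` — two such elements `e ≠ f` would give, by submodularity, `ρ(U ∖ {e, f}) ≤ 1`, while
`U ∖ {e, f}` still contains two elements of rank `2`; (ii) the side-lines `cl {a, b}`, `cl {a, c}` of a triangle
`{a, b, c}` meet only in `a` when `{a, x}` has rank `2` for `x ≠ a` — again by submodularity on `{a, b, x}`, `{a, c, x}`.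
-/

namespace PercRepro.Shadow

open Finset PerFlat ThmH

variable {α : Type*} [DecidableEq α] {M : Matroid α} [M.Finite]

/-- **At most one collinear co-size-`1` subset**: if the elements of `U` are pairwise of rank `2`, `ρ(U) = 3` and
`|U| ≥ 4`, then at most one `e ∈ U` has `ρ(U ∖ {e}) = 2`. -/
theorem card_filter_rkN_erase_eq_two_le_one {U : Finset α}
    (hsimple : ∀ e ∈ U, ∀ f ∈ U, e ≠ f → rkN M {e, f} = 2) (hr : rkN M U = 3) (h4 : 4 ≤ U.card) :
    (U.filter (fun e => rkN M (U.erase e) = 2)).card ≤ 1 := by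
  rw [Finset.card_le_one]
  intro e he f hf
  by_contra hef
  rw [Finset.mem_filter] at he hf
  -- submodularity on `U.erase e` and `U.erase f`
  have hsub := rkN_inter_add_rkN_union_le (M := M) (U.erase e) (U.erase f)
  have hinter : U.erase e ∩ U.erase f = (U.erase e).erase f := by
    ext x
    simp only [Finset.mem_inter, Finset.mem_erase]
    tauto
  have hunion : U.erase e ∪ U.erase f = U := by
    ext x
    simp only [Finset.mem_union, Finset.mem_erase]
    constructor
    · rintro (h | h) <;> exact h.2
    · intro hx
      by_cases hxe : x = e
      · right; exact ⟨hxe ▸ hef, hx⟩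
      · left; exact ⟨hxe, hx⟩
  rw [hinter, hunion, he.2, hf.2, hr] at hsub
  -- `U.erase e |>.erase f` has at least two elements, of rank `2`
  have hcard : 2 ≤ ((U.erase e).erase f).card := by
    rw [Finset.card_erase_of_mem (Finset.mem_erase.2 ⟨fun h => hef h.symm, hf.1⟩),
      Finset.card_erase_of_mem he.1]
    omega
  obtain ⟨g, hg, h, hh, hgh⟩ := Finset.one_lt_card.1 (by omega : 1 < ((U.erase e).erase f).card)
  have hgU : g ∈ U := (Finset.mem_erase.1 (Finset.mem_erase.1 hg).2).2
  have hhU : h ∈ U := (Finset.mem_erase.1 (Finset.mem_erase.1 hh).2).2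
  have hpair : rkN M {g, h} ≤ rkN M ((U.erase e).erase f) := by
    apply rkN_mono
    intro x hx
    rw [Finset.mem_insert, Finset.mem_singleton] at hx
    rcases hx with rfl | rfl
    · exact hg
    · exact hh
  rw [hsimple g hgU h hhU hgh] at hpair
  omega

omit [DecidableEq α] in
/-- The rank of the finset closure equals the rank of the set. -/
theorem rkN_clF (F : Finset α) : rkN M (clF M F) = rkN M F := by
  unfold rkN; rw [coe_clF, M.eRk_closure_eq]

/-- Adding an element of the closure does not raise the rank. -/
theorem rkN_insert_le_of_mem_clF {F : Finset α} (hF : F ⊆ gr M) {x : α} (hx : x ∈ clF M F) :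
    rkN M (insert x F) ≤ rkN M F := by
  have h : insert x F ⊆ clF M F := Finset.insert_subset hx (subset_clF_of_subset_gr hF)
  have := rkN_mono (M := M) h
  rwa [rkN_clF] at this

omit [DecidableEq α] in
/-- The rank of a finset is at most its cardinality. -/
theorem rkN_le_card (F : Finset α) : rkN M F ≤ F.card := by
  unfold rkN
  have := M.eRk_le_encard (F : Set α)
  rw [Set.encard_coe_eq_coe_finsetCard] at this
  exact_mod_cast ENat.toNat_le_of_le_coe this

/-- **The side-lines of a triangle meet only at the vertices**: if `{a, b, c}` has rank `3`, `{a, x}` has rank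
`2` whenever `x ≠ a`, and `x` lies in both `cl {a, b}` and `cl {a, c}`, then `x = a`. -/
theorem eq_of_mem_clF_pair_of_mem_clF_pair {a b c x : α} (hab : ({a, b} : Finset α) ⊆ gr M)
    (hac : ({a, c} : Finset α) ⊆ gr M) (hr : rkN M {a, b, c} = 3) (hax : x ≠ a → rkN M {a, x} = 2)
    (hxab : x ∈ clF M {a, b}) (hxac : x ∈ clF M {a, c}) : x = a := by
  by_contra hxa
  have h1 : rkN M (insert x {a, b}) ≤ 2 := by
    have h := rkN_insert_le_of_mem_clF hab hxab
    have h2 : rkN M {a, b} ≤ 2 := (rkN_le_card _).trans Finset.card_le_two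
    omega
  have h2 : rkN M (insert x {a, c}) ≤ 2 := by
    have h := rkN_insert_le_of_mem_clF hac hxac
    have h2 : rkN M {a, c} ≤ 2 := (rkN_le_card _).trans Finset.card_le_two
    omega
  have hsub := rkN_inter_add_rkN_union_le (M := M) (insert x {a, b}) (insert x {a, c})
  have hU : rkN M {a, b, c} ≤ rkN M (insert x {a, b} ∪ insert x {a, c}) := rkN_mono (by
    intro y hy
    simp only [Finset.mem_insert, Finset.mem_singleton, Finset.mem_union] at hy ⊢
    tauto)
  have hI : rkN M {a, x} ≤ rkN M (insert x {a, b} ∩ insert x {a, c}) := rkN_mono (by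
    intro y hy
    simp only [Finset.mem_insert, Finset.mem_singleton, Finset.mem_inter] at hy ⊢
    tauto)
  have := hax hxa
  omega

end PercRepro.Shadow
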